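import Mathlib
import Summits.NavierStokesRegularity.NavierStokesRegularity.Theorems.EulerZoomLiouvillePowerGaugeEulerLiouvilleNeedleRaceTools
import Summits.NavierStokesRegularity.NavierStokesRegularity.Theorems.EulerZoomLiouvillePowerGaugeEulerLiouvilleSelfSimilarSublinearConfinement
import HarnessLib.Audit

/-!
# Crux E `EulerZoomLiouville.PowerGaugeEulerLiouville` — the needle portrait: THE WAITING-TIME LAW
# (ROUND-37 (F) / ROUND-38, symmetry-free): with thin fast exits, the labels fed through the shell
# `R ≤ ‖·‖ ≤ 2R` within backward similarity time `S` are super-polynomially few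

Route №10 `EulerZoomLiouville` (NavierStokesRegularity), crux E = stmt-NavierStokesRegularity-19832,
registered residue `stub_selfSimilarC2Needle` (THE ONE STATEMENT); memos ROUND-37/38 of the cell
`ns-regularity-ideate` (text custody nsreg-p2).  The EXIT HALF of the feeding-time race
(`NeedleRace.ofReal_mul_volume_exit_le`, t38f ∘ t38g inside) uses NO symmetry and NO profile equation:
only a `C²` divergence-free field `U`, its cut-off similarity flow, and THIN FAST EXITS.  Packaged:

* **`volume_exit_toReal_le_of_thinFastExits`** — `U ∈ C²` divergence-free with thin fast exits at
  exponent `γ > 0` (the `hthin` interface of `…NeedleRace`: for every `m`, for all large `R`, good squared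
  radii `G ⊆ [R², 4R²]` with `|G| ≥ κR²` and a tube `N ⊆ B̄_{2R}` catching every strictly γ-fast point of
  the good spheres, `|N|·∫_N‖U‖² ≤ R^{−m}`).  Then for every `m` there is `R₀ ≥ 1` such that for all
  `R ≥ R₀`, every cut-off `V` (`C²`, `‖DV‖ ≤ K`, `V = U` on `‖·‖ < R_big`, `2R < R_big`), every `S ≥ 0`
  and every measurable blob `B₀ ⊆ B̄_R`:
  `vol{y ∈ B₀ : the backward orbit of y leaves ‖·‖ ≤ 2R before time S} ≤ (4/(κR))·c_S·√(R^{−m})`,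
  `c_S = (e^{3γS} − 1)/(3γ)`.
  Reading (ROUND-38's «stretched waiting room»): feeding a blob through the shell takes backward time longer than
  any multiple of `log R` when the exits are capacity-thin; no symmetry, no profile equation, no clock.
* **`curl_eq_zero_of_logClock_of_thinFastExits`** (T_log) — THE THRESHOLD: a RESIDENCE CLOCK of strength
  `s₁ log R` («around every vortical point a ball at most half of whose labels stay in `‖·‖ ≤ 2R` during backward
  time `s₁ log R`, for all large `R` and every cut-off copy») together with the thin exits forces `curl U ≡ 0`: the
  race template of `…NeedleRace` with the axisymmetric Casimir clock replaced by a hypothesis — what a symmetry-free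
  clock must beat (`exit_arith_logClock`: `m = 6γs₁ + 2` beats `e^{3γ s₁ log R}`).  The power-clock / strong-exit
  twin (T_pow, band-law exponent) is the sequel `…NeedleClockThreshold`.

NOT NS, not E; 19832 OPEN.  References: Constantin–Ignatova–Vicol arXiv:2602.17570 §3.4–§3.5
[ConstantinIgnatovaVicol2026Putative]; (Cauchy–Schwarz, area formula) [folklore].
-/

noncomputable section

-- the summit and its single problem share the name `NavierStokesRegularity` (D-0017 nested layout)
set_option linter.dupNamespace false

open Set Filter Topology Metric Function MeasureTheory InnerProductSpace
open scoped RealInnerProductSpace NNReal ENNReal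

namespace Summit.NavierStokesRegularity.NavierStokesRegularity.Theorems.PowerGaugeEulerLiouville.NeedleRace

open Literature.Analysis Literature.Analysis.FluidPDE
open Summit.NavierStokesRegularity.NavierStokesRegularity.Theorems.PowerGaugeEulerLiouville

variable {γ : ℝ} {U : EuclideanSpace ℝ (Fin 3) → EuclideanSpace ℝ (Fin 3)}

/-- **THE WAITING-TIME LAW (symmetry-free).**  See the module docstring: for a `C²` divergence-free `U`
with thin fast exits, every `m`, all large `R`, every cut-off `V` of `U` beyond `2R`, every `S ≥ 0` and
every measurable `B₀ ⊆ B̄_R`, the labels of `B₀` whose backward similarity orbit does not stay in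
`‖·‖ ≤ 2R` on `[0, S]` have volume `≤ (4/(κR)) · ((e^{3γS} − 1)/(3γ)) · √(R^{−m})`.
[cite: ConstantinIgnatovaVicol2026Putative, §3.4.1 eq. (3.21)-(3.22), §3.5] -/
theorem volume_exit_toReal_le_of_thinFastExits (hdivU : VectorCalculus.IsDivFree U) (hγ : 0 < γ)
    {κ : ℝ} (hκ : 0 < κ)
    (hthin : ∀ m : ℝ, ∃ R₀ : ℝ, ∀ R : ℝ, R₀ ≤ R →
      ∃ (G : Set ℝ) (N : Set (EuclideanSpace ℝ (Fin 3))),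
        MeasurableSet G ∧ G ⊆ Icc (R ^ 2) ((2 * R) ^ 2) ∧ κ * R ^ 2 ≤ (volume G).toReal ∧
        MeasurableSet N ∧ N ⊆ closedBall (0 : EuclideanSpace ℝ (Fin 3)) (2 * R) ∧
        (∀ z : EuclideanSpace ℝ (Fin 3), ‖z‖ ^ 2 ∈ G → ⟪U z, z⟫ + γ * ‖z‖ ^ 2 < 0 → z ∈ N) ∧
        volume N * ∫⁻ z in N, ENNReal.ofReal (‖U z‖ ^ 2) ≤ ENNReal.ofReal (R ^ (-m)))
    (m : ℝ) :
    ∃ R₀ : ℝ, 1 ≤ R₀ ∧ ∀ R : ℝ, R₀ ≤ R →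
      ∀ {V : EuclideanSpace ℝ (Fin 3) → EuclideanSpace ℝ (Fin 3)}, ContDiff ℝ 2 V →
      ∀ {K : ℝ}, (∀ y, ‖fderiv ℝ V y‖ ≤ K) →
      ∀ {Rbig : ℝ}, 2 * R < Rbig → (∀ w ∈ ball (0 : EuclideanSpace ℝ (Fin 3)) Rbig, V w = U w) →
      ∀ {S : ℝ}, 0 ≤ S →
      ∀ {B₀ : Set (EuclideanSpace ℝ (Fin 3))}, MeasurableSet B₀ →
        B₀ ⊆ closedBall (0 : EuclideanSpace ℝ (Fin 3)) R →
        (volume (B₀ \ {y | ∀ σ ∈ Icc 0 S,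
            ‖ODE.evolutionMap (fun _ : ℝ => selfSimilarTransport γ 0 V) 0 (-σ) y‖ ≤ 2 * R})).toReal ≤
          4 / (κ * R) * ((Real.exp (3 * γ * S) - 1) / (3 * γ)) * Real.sqrt (R ^ (-m)) := by
  obtain ⟨R₀, hR₀⟩ := hthin m
  refine ⟨max R₀ 1, le_max_right _ _, ?_⟩
  intro R hR V hV2 K hK Rbig hRbig hVU S hS B₀ hB₀m hB₀R
  have hRR₀ : R₀ ≤ R := (le_max_left _ _).trans hR
  have hR1 : 1 ≤ R := (le_max_right _ _).trans hR
  have hR0 : 0 < R := by linarith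
  obtain ⟨G, N, hGm, hG, hGvol, hNm, hNsub, hLemK, hNJ⟩ := hR₀ R hRR₀
  -- the cut-off field is divergence-free where it agrees with `U`
  have hdiv : ∀ z : EuclideanSpace ℝ (Fin 3), ‖z‖ ≤ 2 * R → VectorCalculus.divergence V z = 0 := by
    intro z hz
    have hzball : z ∈ ball (0 : EuclideanSpace ℝ (Fin 3)) Rbig := mem_ball_zero_iff.2 (by linarith)
    have hev : V =ᶠ[𝓝 z] U := by
      filter_upwards [isOpen_ball.mem_nhds hzball] with w hw using hVU w hw
    unfold VectorCalculus.divergence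
    rw [hev.fderiv_eq]
    exact hdivU z
  -- the EXIT half and the `ℝ≥0∞ → ℝ` bookkeeping
  have h2 := ofReal_mul_volume_exit_le (γ := γ) (U := U) hV2 hK hγ hR0 hRbig hVU hdiv hS hB₀m hB₀R hGm hG
    hNm hNsub hLemK
  set cS : ℝ := (Real.exp (3 * γ * S) - 1) / (3 * γ) with hcS
  have hcS0 : 0 ≤ cS := by
    rw [hcS]
    apply div_nonneg _ (by positivity)
    have : 1 ≤ Real.exp (3 * γ * S) := Real.one_le_exp (by positivity)
    linarith
  set g : ℝ := (volume G).toReal / (4 * R) with hg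
  have hgκ : κ * R / 4 ≤ g := by
    rw [hg, le_div_iff₀ (by positivity)]
    nlinarith [hGvol, hR0, hκ]
  have hgpos : 0 < g := lt_of_lt_of_le (by positivity) hgκ
  have h3 := toReal_le_of_feeding (N := N) hgpos hcS0 (Real.rpow_nonneg hR0.le (-m)) h2 hNJ
  refine h3.trans ?_
  have h4 : cS * Real.sqrt (R ^ (-m)) / g ≤ cS * Real.sqrt (R ^ (-m)) / (κ * R / 4) :=
    div_le_div_of_nonneg_left (by positivity) (by positivity) hgκ
  refine h4.trans (le_of_eq ?_)
  field_simp

/-! ### The threshold: a residence clock of strength `O(log R)` kills the needle -/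

/-- **Exit arithmetic at a log clock**: with `S = s₁ log R` (`s₁ ≥ 0`, `R ≥ 1`) and `m = 6γs₁ + 2` the
waiting-time bound is `(4/(κR)) · ((e^{3γS} − 1)/(3γ)) · √(R^{−m}) ≤ 4/(3γκR²)`. [folklore] -/
theorem exit_arith_logClock {γ κ s₁ R : ℝ} (hγ : 0 < γ) (hκ : 0 < κ) (hs₁ : 0 ≤ s₁) (hR : 1 ≤ R) :
    4 / (κ * R) * ((Real.exp (3 * γ * (s₁ * Real.log R)) - 1) / (3 * γ)) *
        Real.sqrt (R ^ (-(6 * γ * s₁ + 2))) ≤ 4 / (3 * γ * κ * R ^ 2) := by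
  have hR0 : 0 < R := by linarith
  have h3γ : 0 < 3 * γ := by positivity
  have hlogR : 0 ≤ Real.log R := Real.log_nonneg hR
  -- `√(exp x) = exp (x/2)`
  have sqrt_exp : ∀ x : ℝ, Real.sqrt (Real.exp x) = Real.exp (x / 2) := fun x => by
    rw [show Real.exp x = Real.exp (x / 2) ^ 2 by rw [sq, ← Real.exp_add]; congr 1; ring]
    exact Real.sqrt_sq (Real.exp_pos _).le
  have hcS : (Real.exp (3 * γ * (s₁ * Real.log R)) - 1) / (3 * γ) ≤
      Real.exp (3 * γ * s₁ * Real.log R) / (3 * γ) := by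
    rw [show 3 * γ * (s₁ * Real.log R) = 3 * γ * s₁ * Real.log R by ring]
    exact div_le_div_of_nonneg_right (by linarith) h3γ.le
  have hcS0 : 0 ≤ (Real.exp (3 * γ * (s₁ * Real.log R)) - 1) / (3 * γ) := by
    apply div_nonneg _ h3γ.le
    have : 1 ≤ Real.exp (3 * γ * (s₁ * Real.log R)) := Real.one_le_exp (by positivity)
    linarith
  have hsqrt : Real.sqrt (R ^ (-(6 * γ * s₁ + 2))) = Real.exp (-(3 * γ * s₁ + 1) * Real.log R) := by
    rw [Real.rpow_def_of_pos hR0, sqrt_exp]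
    congr 1; ring
  have hprod : Real.exp (3 * γ * s₁ * Real.log R) / (3 * γ) * Real.exp (-(3 * γ * s₁ + 1) * Real.log R) =
      1 / (3 * γ * R) := by
    rw [div_mul_eq_mul_div, ← Real.exp_add,
      show 3 * γ * s₁ * Real.log R + -(3 * γ * s₁ + 1) * Real.log R = -Real.log R by ring,
      Real.exp_neg, Real.exp_log hR0]
    field_simp
  have hstep : (Real.exp (3 * γ * (s₁ * Real.log R)) - 1) / (3 * γ) * Real.sqrt (R ^ (-(6 * γ * s₁ + 2))) ≤
      1 / (3 * γ * R) := by
    rw [hsqrt, ← hprod]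
    exact mul_le_mul_of_nonneg_right hcS (Real.exp_pos _).le
  have hκR : 0 < 4 / (κ * R) := by positivity
  calc 4 / (κ * R) * ((Real.exp (3 * γ * (s₁ * Real.log R)) - 1) / (3 * γ)) *
        Real.sqrt (R ^ (-(6 * γ * s₁ + 2)))
      = 4 / (κ * R) * (((Real.exp (3 * γ * (s₁ * Real.log R)) - 1) / (3 * γ)) *
          Real.sqrt (R ^ (-(6 * γ * s₁ + 2)))) := by ring
    _ ≤ 4 / (κ * R) * (1 / (3 * γ * R)) := mul_le_mul_of_nonneg_left hstep hκR.le
    _ = 4 / (3 * γ * κ * R ^ 2) := by field_simp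

/-- **THE THRESHOLD (T_log): A RESIDENCE CLOCK OF STRENGTH `O(log R)` KILLS THE NEEDLE.**  `U ∈ C²`
divergence-free with thin fast exits at exponent `γ > 0` (the `hthin` interface).  Suppose a RESIDENCE CLOCK of
strength `s₁ log R` (`s₁ ≥ 0`): around every vortical point `x₀` (`curl U x₀ ≠ 0`) there is a ball `B₀ = B(x₀, r)`
such that for all large `R` and every cut-off copy `V` of `U` beyond `2R` (`V ∈ C²`, `‖DV‖ ≤ K`, `V = U` on
`‖·‖ < R_big`, `2R < R_big`) at most HALF of the labels of `B₀` stay in `‖·‖ ≤ 2R` during the backward similarity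
time `s₁ log R`.  Then `curl U ≡ 0`.  (The race template with the axisymmetric Casimir clock `NeedleRace.volume_stay_le`
replaced by the hypothesis; `m = 6γs₁ + 2` in the thin exits beats `e^{3γ s₁ log R}` — ROUND-38 (T_log): this is
the threshold a symmetry-free clock for the `C²` needle must meet.) [folklore; ConstantinIgnatovaVicol2026Putative §3.5] -/
theorem curl_eq_zero_of_logClock_of_thinFastExits (hU2 : ContDiff ℝ 2 U) (hdivU : VectorCalculus.IsDivFree U)
    (hγ : 0 < γ) {κ : ℝ} (hκ : 0 < κ)
    (hthin : ∀ m : ℝ, ∃ R₀ : ℝ, ∀ R : ℝ, R₀ ≤ R →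
      ∃ (G : Set ℝ) (N : Set (EuclideanSpace ℝ (Fin 3))),
        MeasurableSet G ∧ G ⊆ Icc (R ^ 2) ((2 * R) ^ 2) ∧ κ * R ^ 2 ≤ (volume G).toReal ∧
        MeasurableSet N ∧ N ⊆ closedBall (0 : EuclideanSpace ℝ (Fin 3)) (2 * R) ∧
        (∀ z : EuclideanSpace ℝ (Fin 3), ‖z‖ ^ 2 ∈ G → ⟪U z, z⟫ + γ * ‖z‖ ^ 2 < 0 → z ∈ N) ∧
        volume N * ∫⁻ z in N, ENNReal.ofReal (‖U z‖ ^ 2) ≤ ENNReal.ofReal (R ^ (-m)))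
    {s₁ : ℝ} (hs₁ : 0 ≤ s₁)
    (hclock : ∀ x₀ : EuclideanSpace ℝ (Fin 3), curl U x₀ ≠ 0 → ∃ r : ℝ, 0 < r ∧ ∃ R₀ : ℝ, ∀ R : ℝ, R₀ ≤ R →
      ∀ (V : EuclideanSpace ℝ (Fin 3) → EuclideanSpace ℝ (Fin 3)) (K Rbig : ℝ), ContDiff ℝ 2 V →
        (∀ y, ‖fderiv ℝ V y‖ ≤ K) → 2 * R < Rbig →
        (∀ w ∈ ball (0 : EuclideanSpace ℝ (Fin 3)) Rbig, V w = U w) →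
        (volume (ball x₀ r ∩ {y | ∀ σ ∈ Icc 0 (s₁ * Real.log R),
          ‖ODE.evolutionMap (fun _ : ℝ => selfSimilarTransport γ 0 V) 0 (-σ) y‖ ≤ 2 * R})).toReal ≤
          (volume (ball x₀ r)).toReal / 2)
    (x₀ : EuclideanSpace ℝ (Fin 3)) : curl U x₀ = 0 := by
  by_contra hx₀
  -- ### the blob and the clock
  obtain ⟨r, hr, R₁, hR₁⟩ := hclock x₀ hx₀
  set B₀ : Set (EuclideanSpace ℝ (Fin 3)) := ball x₀ r with hB₀
  have hB₀m : MeasurableSet B₀ := measurableSet_ball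
  have hv₀pos : 0 < volume B₀ := measure_ball_pos volume x₀ hr
  have hv₀top : volume B₀ < ⊤ := measure_ball_lt_top
  set v₀ : ℝ := (volume B₀).toReal with hv₀
  have hv₀0 : 0 < v₀ := ENNReal.toReal_pos hv₀pos.ne' hv₀top.ne
  -- ### the waiting-time law at `m = 6γs₁ + 2`
  obtain ⟨R₂, hR₂1, hR₂⟩ := volume_exit_toReal_le_of_thinFastExits (γ := γ) hdivU hγ hκ hthin (6 * γ * s₁ + 2)
  -- ### the radius
  set R : ℝ := max (max R₁ R₂) (max (‖x₀‖ + r) (16 / (3 * γ * κ * v₀) + 1)) with hRdef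
  have hRR₁ : R₁ ≤ R := (le_max_left _ _).trans (le_max_left _ _)
  have hRR₂ : R₂ ≤ R := (le_max_right _ _).trans (le_max_left _ _)
  have hRx : ‖x₀‖ + r ≤ R := (le_max_left _ _).trans (le_max_right _ _)
  have hRv : 16 / (3 * γ * κ * v₀) + 1 ≤ R := (le_max_right _ _).trans (le_max_right _ _)
  have hR1 : 1 ≤ R := hR₂1.trans hRR₂
  have hR0 : 0 < R := by linarith
  set S : ℝ := s₁ * Real.log R with hSdef
  have hS : 0 ≤ S := mul_nonneg hs₁ (Real.log_nonneg hR1)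
  -- ### the cut-off field
  set Rbig : ℝ := 2 * R + 1 with hRbigdef
  obtain ⟨V, hV2, -, -, ⟨K, hK⟩, hVU⟩ := Loc.exists_cutoff_local hU2 (R := Rbig) (by positivity)
  have hRbig : 2 * R < Rbig := by rw [hRbigdef]; linarith
  set Φ := ODE.evolutionMap (fun _ : ℝ => selfSimilarTransport γ 0 V) 0 with hΦ
  -- ### the blob sits in `B̄_R`
  have hB₀R : B₀ ⊆ closedBall (0 : EuclideanSpace ℝ (Fin 3)) R := by
    intro y hy
    rw [hB₀, mem_ball] at hy
    rw [mem_closedBall_zero_iff]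
    have h1 : ‖y‖ ≤ ‖y - x₀‖ + ‖x₀‖ := norm_le_norm_sub_add y x₀
    rw [← dist_eq_norm] at h1
    linarith
  -- ### the two halves
  set Stay : Set (EuclideanSpace ℝ (Fin 3)) := {y | ∀ σ ∈ Icc 0 S, ‖Φ (-σ) y‖ ≤ 2 * R} with hStay
  have hStaym : MeasurableSet Stay := (isClosed_backwardStay (γ := γ) hV2 hK S (2 * R)).measurableSet
  have h1 : (volume (B₀ ∩ Stay)).toReal ≤ v₀ / 2 := hR₁ R hRR₁ V K Rbig hV2 hK hRbig hVU
  have h2 : (volume (B₀ \ Stay)).toReal ≤ 4 / (3 * γ * κ * R ^ 2) :=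
    (hR₂ R hRR₂ hV2 hK hRbig hVU hS hB₀m hB₀R).trans (exit_arith_logClock hγ hκ hs₁ hR1)
  -- `4/(3γκR²) < v₀/2`
  have h3 : 4 / (3 * γ * κ * R ^ 2) < v₀ / 2 := by
    have hRv' : 16 / (3 * γ * κ * v₀) < R := by linarith
    have hden : 0 < 3 * γ * κ * v₀ := by positivity
    rw [div_lt_iff₀ hden] at hRv'
    rw [div_lt_iff₀ (by positivity)]
    have hRR : R ≤ R ^ 2 := by nlinarith
    nlinarith [mul_pos (mul_pos (mul_pos three_pos hγ) hκ) hv₀0, hRR]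
  -- ### the sum
  have hsplit : volume (B₀ ∩ Stay) + volume (B₀ \ Stay) = volume B₀ := measure_inter_add_sdiff B₀ hStaym
  have hfin1 : volume (B₀ ∩ Stay) ≠ ⊤ := ((measure_mono inter_subset_left).trans_lt hv₀top).ne
  have hfin2 : volume (B₀ \ Stay) ≠ ⊤ := ((measure_mono Set.sdiff_subset).trans_lt hv₀top).ne
  have hsum : v₀ = (volume (B₀ ∩ Stay)).toReal + (volume (B₀ \ Stay)).toReal := by
    rw [hv₀, ← hsplit, ENNReal.toReal_add hfin1 hfin2]
  linarith

end Summit.NavierStokesRegularity.NavierStokesRegularity.Theorems.PowerGaugeEulerLiouville.NeedleRace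

end
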